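import Literature.Computability.AlgebraicComplexity.LevelTriples
import HarnessLib

/-!
# Interface tensors only depend on the parameter LIST: relabelling the chunks
(Vassilevska Williams–Xu–Xu–Zhou 2024, Def. 4.1 / §5.5–§5.7: the copies of `𝒯*` over different
block triples are copies of ONE tensor) — proved

Topic `Literature/Computability/AlgebraicComplexity`.  In `InterfaceTensors.lean` a parameter list
`{(n_t, i_t, j_t, k_t, γ_X^{(t)}, γ_Y^{(t)}, γ_Z^{(t)})}_t` of Def. 4.1 of Vassilevska Williams–Xu–Xu–Zhou
(SODA 2024, arXiv:2307.07970) is presented by a term map `τ : Fin n → Fin s` (WHICH chunks belong to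
term `t`, not only how many).  The paper's object only records the multiplicities `n_t`; accordingly
§5.5–§5.7 treat the useful sub-tensors over ALL remaining block triples `X_I Y_J Z_K` consistent with
`α` — whose term maps `t ↦ (I_t, J_t, K_t)` (`tripleTermMap`, `LevelTriples.lean`) differ but have
the same fibre sizes `|S_{i,j,k}| = A₁ α(i,j,k) n` — as "copies of `𝒯*`" ("`𝒯'''` contains
`numalpha · M^{-1-o(1)}` copies of `𝒯*` whose fraction of holes is …", §5.6).  This file PROVES that
this is justified, by RESTRICTIONS in both directions (indeed a relabelling of the variables):

* `chunkPerm_mem_admissibleSeqs_relabel_iff` — for any permutation `σ` of the chunks,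
  `σ · Î` is admissible for the term map `τ ∘ σ⁻¹` iff `Î` is admissible for `τ` (any `ε`);
* `interfaceTensor_relabel` — `𝒯_{τ∘σ⁻¹}(σ·x, σ·y, σ·z) = 𝒯_τ(x, y, z)`, hence
  `tensorRestrictsTo_interfaceTensor_relabel` : `𝒯_τ ≥ 𝒯_{τ∘σ⁻¹}` (and conversely with `σ⁻¹`);
* `tensorRestrictsTo_interfaceTensor_of_letterCount_eq` — **term maps with the same fibre sizes
  (`letterCount τ = letterCount τ'`, i.e. the same `n_t` for every `t`) give mutually restricting
  interface tensors** (`exists_perm_of_letterCount_eq`);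
* `tensorRestrictsTo_usefulSubtensor_of_isAlphaConsistent` — in particular the useful sub-tensors
  `𝒯*_{(I,J,K)}` (`usefulSubtensor`, Claim 5.11) over any two `α`-consistent block triples restrict
  to each other: they are copies of one level-`ℓ` interface tensor `𝒯*`.

Everything is proved; no definitions, no named facts.

## References

* V. Vassilevska Williams, Y. Xu, Z. Xu, R. Zhou, *New bounds for matrix multiplication: from alpha
  to omega*, SODA 2024, arXiv:2307.07970 (held: `paper:arxiv-2307.07970`): Def. 4.1 (parameter
  lists), §5.5 (Claim 5.11: "𝒯* … the level-ℓ interface tensor with parameter list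
  {(A₁ α(i,j,k) n, i, j, k, …)}"), §5.6–§5.7 ("copies of 𝒯*"). [VassilevskaWilliamsXuXuZhou2024]
-/

noncomputable section

open scoped BigOperators
open Finset

namespace Literature.Computability.AlgebraicComplexity

open Literature.Barriers.MatrixMultiplication (bigCwTensor)

universe u

/-! ## Relabelling the chunks changes the term map by the permutation -/

section Relabel

variable {c n s : ℕ}

/-- The chunk set of term `t` for the relabelled term map `τ ∘ σ⁻¹` is the `σ`-image of that of `τ`:
`σ u ∈ (τ ∘ σ⁻¹)⁻¹(t) ↔ u ∈ τ⁻¹(t)`. [folklore] -/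
theorem perm_mem_fibre_relabel_iff (τ : Fin n → Fin s) (σ : Equiv.Perm (Fin n)) (t : Fin s) (u : Fin n) :
    σ u ∈ (univ.filter fun v => (τ ∘ σ.symm) v = t) ↔ u ∈ (univ.filter fun v => τ v = t) := by
  simp

/-- Counting through the relabelling: `#{v ∈ (τ∘σ⁻¹)⁻¹(t) | (σ·Î)_v = a} = #{u ∈ τ⁻¹(t) | Î_u = a}`.
[folklore] -/
theorem card_filter_fibre_relabel {α : Type*} [DecidableEq α] (τ : Fin n → Fin s) (σ : Equiv.Perm (Fin n))
    (t : Fin s) (I : Fin n → α) (a : α) :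
    ((univ.filter fun v => (τ ∘ σ.symm) v = t).filter fun v => chunkPerm σ I v = a).card =
      ((univ.filter fun u => τ u = t).filter fun u => I u = a).card := by
  refine card_bij (fun v _ => σ.symm v) (fun v hv => ?_) (fun v₁ _ v₂ _ h => by simpa using h)
    (fun u hu => ⟨σ u, ?_, by simp⟩)
  · simp only [mem_filter, mem_univ, true_and, Function.comp_apply, chunkPerm_apply] at hv ⊢
    exact hv
  · simp only [mem_filter, mem_univ, true_and, Function.comp_apply, chunkPerm_apply,
      Equiv.symm_apply_apply] at hu ⊢
    exact hu

/-- `split(σ·Î, (τ∘σ⁻¹)⁻¹(t)) = split(Î, τ⁻¹(t))`. [cite: VassilevskaWilliamsXuXuZhou2024, Def. 3.5 and Def. 4.1] -/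
theorem completeSplitOn_fibre_relabel (τ : Fin n → Fin s) (σ : Equiv.Perm (Fin n)) (t : Fin s)
    (I : Fin n → Fin c → Fin 3) :
    completeSplitOn (chunkPerm σ I) (univ.filter fun v => (τ ∘ σ.symm) v = t) =
      completeSplitOn I (univ.filter fun u => τ u = t) := by
  funext a
  rw [completeSplitOn_apply, completeSplitOn_apply, card_filter_fibre_relabel]
  congr 2
  have := card_filter_fibre_relabel τ σ t (fun _ : Fin n => (0 : ℕ)) 0
  simpa using this

/-- **Admissibility is transported by relabelling the chunks**: `σ·Î` is admissible for the term map
`τ ∘ σ⁻¹` iff `Î` is admissible for `τ` (for every `ε`; the case `τ ∘ σ⁻¹ = τ` is the chunk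
symmetry `chunkPerm_mem_admissibleSeqs_iff`). [cite: VassilevskaWilliamsXuXuZhou2024, Def. 4.1] -/
theorem chunkPerm_mem_admissibleSeqs_relabel_iff (τ : Fin n → Fin s) (σ : Equiv.Perm (Fin n))
    (deg : Fin s → ℕ) (γ : Fin s → (Fin c → Fin 3) → ℝ) (ε : ℝ) (I : Fin n → Fin c → Fin 3) :
    chunkPerm σ I ∈ admissibleSeqs (τ ∘ σ.symm) deg γ ε ↔ I ∈ admissibleSeqs τ deg γ ε := by
  rw [mem_admissibleSeqs, mem_admissibleSeqs]
  refine and_congr ?_ (forall_congr' fun t => ?_)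
  · constructor
    · intro h u
      have := h (σ u)
      simpa using this
    · intro h v
      have := h (σ.symm v)
      simpa using this
  · have hne : (univ.filter fun v => (τ ∘ σ.symm) v = t).Nonempty ↔ (univ.filter fun u => τ u = t).Nonempty := by
      constructor
      · rintro ⟨v, hv⟩
        exact ⟨σ.symm v, by simpa using hv⟩
      · rintro ⟨u, hu⟩
        exact ⟨σ u, by simpa using hu⟩
    rw [hne, SplitConsistentOn, SplitConsistentOn, completeSplitOn_fibre_relabel]

variable (K : Type u) [CommSemiring K] (q : ℕ)

/-- **`𝒯_{τ∘σ⁻¹}(σ·x, σ·y, σ·z) = 𝒯_τ(x, y, z)`**: relabelling the chunks of the variables turns the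
interface tensor of `τ` into that of `τ ∘ σ⁻¹` (same parameters `L`, any `ε`).
[cite: VassilevskaWilliamsXuXuZhou2024, Def. 4.1] -/
theorem interfaceTensor_relabel (τ : Fin n → Fin s) (σ : Equiv.Perm (Fin n)) (L : Fin s → InterfaceTerm c)
    (ε : ℝ) (x y z : Fin n → Fin c → Fin (q + 2)) :
    interfaceTensor K q (τ ∘ σ.symm) L ε (chunkPerm σ x) (chunkPerm σ y) (chunkPerm σ z) =
      interfaceTensor K q τ L ε x y z := by
  simp only [interfaceTensor, partSubtensor_apply, levelSeq_chunkPerm, levelBlocksX, levelBlocksY,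
    levelBlocksZ, chunkPerm_mem_admissibleSeqs_relabel_iff, kroneckerPow_chunkPerm]

/-- **`𝒯_τ ≥ 𝒯_{τ∘σ⁻¹}`** (a relabelling of the variables, in particular a restriction).
[cite: VassilevskaWilliamsXuXuZhou2024, Def. 4.1] -/
theorem tensorRestrictsTo_interfaceTensor_relabel (τ : Fin n → Fin s) (σ : Equiv.Perm (Fin n))
    (L : Fin s → InterfaceTerm c) (ε : ℝ) :
    TensorRestrictsTo (interfaceTensor K q τ L ε) (interfaceTensor K q (τ ∘ σ.symm) L ε) := by
  have hcancel : ∀ {α : Type} (w : Fin n → α), chunkPerm σ (chunkPerm σ⁻¹ w) = w := by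
    intro α w
    rw [← Equiv.Perm.mul_apply, ← chunkPerm_mul, mul_inv_cancel, chunkPerm_one, Equiv.Perm.one_apply]
  have key : interfaceTensor K q (τ ∘ σ.symm) L ε = fun x y z =>
      interfaceTensor K q τ L ε (chunkPerm σ⁻¹ x) (chunkPerm σ⁻¹ y) (chunkPerm σ⁻¹ z) := by
    funext x y z
    have h := interfaceTensor_relabel K q τ σ L ε (chunkPerm σ⁻¹ x) (chunkPerm σ⁻¹ y) (chunkPerm σ⁻¹ z)
    rw [hcancel, hcancel, hcancel] at h
    exact h
  rw [key]
  exact TensorRestrictsTo.comap _ _ _ _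

/-- **Interface tensors with the same fibre sizes restrict to each other**: if `τ, τ' : Fin n → Fin s`
have `letterCount τ = letterCount τ'` (the same number `n_t` of chunks in every term — the only
datum of the printed parameter list), then `𝒯_τ ≥ 𝒯_{τ'}` (and symmetrically), for the same
parameters `L` and every `ε`. [cite: VassilevskaWilliamsXuXuZhou2024, Def. 4.1 (parameter list {(n_t, …)})] -/
theorem tensorRestrictsTo_interfaceTensor_of_letterCount_eq {τ τ' : Fin n → Fin s}
    (h : letterCount τ = letterCount τ') (L : Fin s → InterfaceTerm c) (ε : ℝ) :
    TensorRestrictsTo (interfaceTensor K q τ L ε) (interfaceTensor K q τ' L ε) := by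
  -- `τ ∘ σ = τ'` for a permutation `σ`
  obtain ⟨σ, hσ⟩ := exists_perm_of_letterCount_eq h.symm
  have hτ' : τ' = τ ∘ (σ⁻¹).symm := by
    funext v
    simp only [Function.comp_apply, Equiv.Perm.inv_def, Equiv.symm_symm]
    exact (hσ v).symm
  rw [hτ']
  exact tensorRestrictsTo_interfaceTensor_relabel K q τ σ⁻¹ L ε

end Relabel

/-! ## The useful sub-tensors over `α`-consistent triples are copies of one `𝒯*` -/

section Copies

variable (R : Type u) [CommSemiring R] (q : ℕ) {c n : ℕ}

/-- The fibre sizes of the term map of a block triple are the class sizes `|S_{i,j,k}|`.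
[cite: VassilevskaWilliamsXuXuZhou2024, §5.3 and §5.5] -/
theorem letterCount_tripleTermMap {I J K : Fin n → ℕ} (h : IsLevelTriple c I J K)
    (s : Fin (constituentTriples c).card) :
    letterCount (tripleTermMap h) s =
      (posClass I J K ((constituentTriples c).equivFin.symm s).1.1 ((constituentTriples c).equivFin.symm s).1.2.1
        ((constituentTriples c).equivFin.symm s).1.2.2).card := by
  rw [letterCount_apply, filter_tripleTermMap_eq h s]

/-- `α`-consistent triples have the same term-map types. [cite: VassilevskaWilliamsXuXuZhou2024, §5.2 ("consistent with α") and §5.5] -/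
theorem letterCount_tripleTermMap_eq_of_isAlphaConsistent {α : ℕ × ℕ × ℕ → ℝ}
    {I J K I' J' K' : Fin n → ℕ} (h : IsLevelTriple c I J K) (h' : IsLevelTriple c I' J' K')
    (hα : IsAlphaConsistent α I J K) (hα' : IsAlphaConsistent α I' J' K') :
    letterCount (tripleTermMap h) = letterCount (tripleTermMap h') := by
  funext s
  rw [letterCount_tripleTermMap h, letterCount_tripleTermMap h']
  have e := hα ((constituentTriples c).equivFin.symm s).1.1 ((constituentTriples c).equivFin.symm s).1.2.1
    ((constituentTriples c).equivFin.symm s).1.2.2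
  have e' := hα' ((constituentTriples c).equivFin.symm s).1.1 ((constituentTriples c).equivFin.symm s).1.2.1
    ((constituentTriples c).equivFin.symm s).1.2.2
  exact_mod_cast e.trans e'.symm

/-- **The useful sub-tensors over two `α`-consistent block triples restrict to each other** — they
are copies of ONE level-`ℓ` interface tensor `𝒯*` with parameter list
`{(A₁ α(i,j,k) n, i, j, k, γ_{X,i,j,k}, γ_{Y,i,j,k}, γ_{Z,i,j,k})}_{i+j+k=2^ℓ}` (Claim 5.11; §5.6: "copies of
`𝒯*`"). [cite: VassilevskaWilliamsXuXuZhou2024, Claim 5.11 and §5.6] -/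
theorem tensorRestrictsTo_usefulSubtensor_of_isAlphaConsistent {α : ℕ × ℕ × ℕ → ℝ}
    {I J K I' J' K' : Fin n → ℕ} (h : IsLevelTriple c I J K) (h' : IsLevelTriple c I' J' K')
    (hα : IsAlphaConsistent α I J K) (hα' : IsAlphaConsistent α I' J' K')
    (γX γY γZ : ℕ × ℕ × ℕ → (Fin c → Fin 3) → ℝ) :
    TensorRestrictsTo (usefulSubtensor R q I J K γX γY γZ) (usefulSubtensor R q I' J' K' γX γY γZ) := by
  rw [usefulSubtensor_eq_interfaceTensor R q h, usefulSubtensor_eq_interfaceTensor R q h']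
  exact tensorRestrictsTo_interfaceTensor_of_letterCount_eq R q
    (letterCount_tripleTermMap_eq_of_isAlphaConsistent h h' hα hα') _ 0

end Copies

end Literature.Computability.AlgebraicComplexity
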